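import Summits.HubbardSuperconductivity.HubbardSuperconductivity.Theorems.AnisotropyChordTransferFibre3F2Decomp
import Summits.HubbardSuperconductivity.HubbardSuperconductivity.Theorems.AnisotropyChordTransferFibre3GradSNormClosed
import Summits.HubbardSuperconductivity.HubbardSuperconductivity.Theorems.AnisotropyChordTransferFibre3TwoMagnon
import Summits.HubbardSuperconductivity.HubbardSuperconductivity.Theorems.AnisotropyChordTransferFibre3PiFourier
import Summits.HubbardSuperconductivity.HubbardSuperconductivity.Theorems.AnisotropyChordTransferFibre3TauTailBound
import Summits.HubbardSuperconductivity.HubbardSuperconductivity.Theorems.AnisotropyChordTransferFibre3Lam2Bounds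

/-!
# Route `AnisotropyChord` / H0 rotor rung: PartN41-B §2 — `PhiHatClosedPlusTail`, `TauTailBoundC`, `PhiHatNearClosed` PROVED

Theory-1 g22's PartN41-B §2 (ported …Fibre3N1Row): for a ground profile `f = 1 − s − aδ₀` and a nearest neighbour `e`,
`f·D_e f = ½(f² − f²(·−e) + (D_e f)²)` and `(D_e f)² = (D_e s)² + q(δ₀ + δ_e)` (`q = a(2f_nn − a) = qPar`), hence
★ `phiHatClosedPlusTail_holds` (`L ≥ 5`, `0 ≤ Δ`): `φ̂_e(0) = γ` and, for `k ≠ 0`,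
`φ̂_e(k) = μ_e(k) + ½(1 − e^{−ik·e}) t(k) + ½ τ_e(k)` (`F₂ = c + t` from …F2Decomp, `dft_even_eq_re`);
★ `tauTailBoundC_holds` (`‖τ_e(k)‖ ≤ Σ (D_e s)²`, triangle inequality); ★ `phiHatNearClosed_holds` (`L ≥ 5`, `0 ≤ Δ`):
`‖φ̂_e(k) − μ_e(k)‖ ≤ ½‖1 − e^{−ik·e}‖|t(k)| + ½τ̄` (`GradSNormClosed`).
Small Fourier lemmas: `dft_shift_sub` (`FT[g(·−e)](k) = e^{−ik·e} ĝ(k)`), `dft_delta_pair`.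
Prover seat `hubbard-h0-rotor-p1` g26 (route lead); helper for stmt-HubbardSuperconductivity-23918 (`--supports`, helper class).
WHAT THIS IS NOT: nothing here proves superconductivity in the Hubbard model; Fourier bookkeeping of ONE row of ONE conditional
reduction.  Tree imports only; no new definitions; no sorry, no axioms.
-/

set_option linter.dupNamespace false
set_option autoImplicit false

noncomputable section

open scoped BigOperators

namespace Summit.HubbardSuperconductivity.HubbardSuperconductivity.Theorems.AnisotropyChord.Transfer.Fibre3

variable (L : ℕ) [NeZero L]

namespace OuterMaj

/-! ## Small Fourier lemmas -/

/-- `FT[g(· − e)](k) = e^{−ik·e}·ĝ(k)`. [folklore] -/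
theorem dft_shift_sub (g : Tor L → ℝ) (k e : Tor L) :
    dft L (fun r => g (r - e)) k = zPh L k e * dft L g k := by
  unfold dft zPh
  rw [Finset.mul_sum]
  refine Fintype.sum_equiv (Equiv.subRight e) _ _ fun r => ?_
  simp only [Equiv.subRight_apply]
  have : phase L k r = phase L k (r - e) * phase L k e := by
    rw [← phase_add]; congr 1; abel
  rw [this, map_mul]
  ring

/-- `FT[q(δ₀ + δ_e)](k) = q(1 + e^{−ik·e})`. [folklore] -/
theorem dft_delta_pair (q : ℝ) (k e : Tor L) :
    dft L (fun r => q * ((if r = 0 then (1 : ℝ) else 0) + (if r = e then (1 : ℝ) else 0))) k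
      = (q : ℂ) * (1 + zPh L k e) := by
  classical
  unfold dft zPh
  have hpt : ∀ r : Tor L, (starRingEnd ℂ) (phase L k r)
        * (((fun r => q * ((if r = 0 then (1 : ℝ) else 0) + (if r = e then (1 : ℝ) else 0))) r : ℝ) : ℂ)
      = (if r = 0 then (q : ℂ) * (starRingEnd ℂ) (phase L k r) else 0)
        + (if r = e then (q : ℂ) * (starRingEnd ℂ) (phase L k r) else 0) := by
    intro r
    simp only []
    split_ifs <;> push_cast <;> ring
  rw [Finset.sum_congr rfl fun r _ => hpt r, Finset.sum_add_distrib, Finset.sum_ite_eq' Finset.univ (0 : Tor L),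
    Finset.sum_ite_eq' Finset.univ e]
  simp only [Finset.mem_univ, if_true]
  rw [phase_zero, map_one]
  ring

/-! ## The gradient of `f` versus the gradient of `s` -/

/-- `(D_e f)² = (D_e s)² + q(δ₀ + δ_e)` pointwise, for a two-magnon profile and a nearest neighbour `e`. [folklore] -/
theorem dgrad_f_sq (hL : 2 ≤ L) {Δ lam2 : ℝ} {f : Tor L → ℝ} (hf : IsGroundTwoMagnon L Δ lam2 f)
    {e : Tor L} (he : e ∈ nnList L) (r : Tor L) :
    Dgrad L f e r ^ 2 = Dgrad L (sfun' L Δ f) e r ^ 2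
      + qPar L Δ f * ((if r = 0 then (1 : ℝ) else 0) + (if r = e then (1 : ℝ) else 0)) := by
  have hf0 : f 0 = 0 := hf.1.1
  have hfe : f e = f (K1 L) := hf.1.2.1 e he
  have hev : ∀ r : Tor L, f (-r) = f r := hf.2.1
  have he0 : e ≠ 0 := by
    have h1 : (1 : ZMod L) ≠ 0 := fun h => K1_ne_zero L hL (Prod.ext h rfl)
    simp only [nnList, List.mem_cons, List.not_mem_nil, or_false] at he
    rcases he with rfl | rfl | rfl | rfl
    · exact fun h => h1 (congrArg Prod.fst h)
    · exact fun h => h1 (neg_eq_zero.1 (congrArg Prod.fst h))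
    · exact fun h => h1 (congrArg Prod.snd h)
    · exact fun h => h1 (neg_eq_zero.1 (congrArg Prod.snd h))
  unfold Dgrad sfun' qPar
  by_cases hr0 : r = 0
  · subst hr0
    have hne : ¬ ((0 : Tor L) - e = 0) := by rw [zero_sub, neg_eq_zero]; exact he0
    rw [if_pos rfl, if_neg hne, if_pos rfl, if_neg (Ne.symm he0), hf0, zero_sub, zero_sub, hev, hfe]
    ring
  · by_cases hre : r = e
    · subst hre
      rw [if_neg hr0, if_pos (sub_self r), if_neg hr0, if_pos rfl, sub_self, hf0, hfe]
      ring
    · have hne : ¬ (r - e = 0) := fun h => hre (sub_eq_zero.1 h)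
      rw [if_neg hr0, if_neg hne, if_neg hr0, if_neg hre]
      ring

/-- `FT[(D_e f)²](k) = τ_e(k) + q(1 + e^{−ik·e})`. [folklore] -/
theorem dft_dgrad_f_sq (hL : 2 ≤ L) {Δ lam2 : ℝ} {f : Tor L → ℝ} (hf : IsGroundTwoMagnon L Δ lam2 f)
    {e : Tor L} (he : e ∈ nnList L) (k : Tor L) :
    dft L (fun r => Dgrad L f e r ^ 2) k = tauC L Δ f e k + (qPar L Δ f : ℂ) * (1 + zPh L k e) := by
  rw [← dft_delta_pair]
  unfold tauC dft
  rw [← Finset.sum_add_distrib]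
  refine Finset.sum_congr rfl fun r _ => ?_
  simp only []
  rw [dgrad_f_sq L hL hf he r]
  push_cast
  ring

/-- `φ̂_e(k) = ½(1 − e^{−ik·e})·FT[f²](k) + ½ FT[(D_e f)²](k)` (product rule `f·D_e f = ½(f² − f²(·−e) + (D_e f)²)`).
[folklore] -/
theorem phiHat_eq_half (f : Tor L → ℝ) (e k : Tor L) :
    phiHat L f e k = (1 / 2 : ℂ) * (1 - zPh L k e) * dft L (fun r => f r ^ 2) k
      + (1 / 2 : ℂ) * dft L (fun r => Dgrad L f e r ^ 2) k := by
  have hshift := dft_shift_sub L (fun r => f r ^ 2) k e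
  unfold phiHat
  unfold dft at hshift ⊢
  have hpt : ∀ r : Tor L, (starRingEnd ℂ) (phase L k r) * (((fun r => f r * Dgrad L f e r) r : ℝ) : ℂ)
      = (1 / 2 : ℂ) * ((starRingEnd ℂ) (phase L k r) * (((fun r => f r ^ 2) r : ℝ) : ℂ))
        - (1 / 2 : ℂ) * ((starRingEnd ℂ) (phase L k r) * (((fun r => (fun r => f r ^ 2) (r - e)) r : ℝ) : ℂ))
        + (1 / 2 : ℂ) * ((starRingEnd ℂ) (phase L k r) * (((fun r => Dgrad L f e r ^ 2) r : ℝ) : ℂ)) := by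
    intro r
    simp only [Dgrad]
    push_cast
    ring
  rw [Finset.sum_congr rfl fun r _ => hpt r, Finset.sum_add_distrib, Finset.sum_sub_distrib, ← Finset.mul_sum,
    ← Finset.mul_sum, ← Finset.mul_sum, hshift]
  ring

/-! ## `PhiHatClosedPlusTail` -/

/-- ★ `PhiHatClosedPlusTail L Δ` holds (`L ≥ 5`, `0 ≤ Δ`). [folklore] -/
theorem phiHatClosedPlusTail_holds (hL : 5 ≤ L) {Δ : ℝ} (hΔ0 : 0 ≤ Δ) : PhiHatClosedPlusTail L Δ := by
  intro lam2 f hf h0 e he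
  have hL2 : 2 ≤ L := by omega
  have hev : ∀ r : Tor L, f (-r) = f r := hf.2.1
  have hev2 : ∀ r : Tor L, (fun r => f r ^ 2) (-r) = (fun r => f r ^ 2) r := by
    intro r; simp only [hev r]
  have hrule := lam2_sum_rule L (by omega) hf.1
  constructor
  · -- `k = 0`
    rw [phiHat_eq_half, dft_dgrad_f_sq L hL2 hf he 0]
    unfold zPh
    rw [phase_zero_left, map_one, sub_self]
    unfold tauC
    rw [dft_zero, dft_zero, gradSNormClosed_holds L (by omega) Δ lam2 f hf e he]
    have hLpos : (0 : ℝ) < L := by exact_mod_cast (show 0 < L by omega)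
    have hV : (L : ℝ) ^ 2 ≠ 0 := by positivity
    have hVX : (L : ℝ) ^ 2 * lam2 / 4 * ((1 + (∑ r : Tor L, sfun' L Δ f r ^ 2) - (1 - Δ * f (K1 L)) ^ 2) / (L : ℝ) ^ 2)
        = lam2 * (1 + (∑ r : Tor L, sfun' L Δ f r ^ 2) - (1 - Δ * f (K1 L)) ^ 2) / 4 := by
      field_simp
    have key : (2 * etaEff L lam2 * (1 - Δ * f (K1 L)
          + (1 + (∑ r : Tor L, sfun' L Δ f r ^ 2) - (1 - Δ * f (K1 L)) ^ 2) / (L : ℝ) ^ 2)) / 2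
        + qPar L Δ f = gamPar L Δ lam2 f := by
      unfold gamPar nf2V sNormSq aPar qPar etaEff
      linear_combination (-(Δ * f (K1 L)) / 4) * hrule + hVX
    rw [← key]
    push_cast
    ring
  · intro k hk
    rw [phiHat_eq_half, dft_dgrad_f_sq L hL2 hf he k, dft_even_eq_re L hev2 k]
    have hF : (dft L (fun r => f r ^ 2) k).re = F2 L f k := rfl
    rw [hF, (f2ClosedPlusTail_holds L hL hΔ0 lam2 f hf h0).2 k hk]
    unfold muK betaK cK
    push_cast
    ring

/-! ## `TauTailBoundC`, `PhiHatNearClosed` -/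

/-- ★ `TauTailBoundC L Δ` holds: `‖τ_e(k)‖ ≤ Σ (D_e s)²`. [folklore] -/
theorem tauTailBoundC_holds (Δ : ℝ) : TauTailBoundC L Δ := by
  intro f e k
  unfold tauC
  refine (norm_dft_le_sum_abs L _ k).trans (le_of_eq ?_)
  refine Finset.sum_congr rfl fun r _ => ?_
  exact abs_of_nonneg (sq_nonneg _)

/-- ★ `PhiHatNearClosed L Δ` holds (`L ≥ 5`, `0 ≤ Δ`): `‖φ̂_e(k) − μ_e(k)‖ ≤ ½‖1 − e^{−ik·e}‖·|t(k)| + ½τ̄`. [folklore] -/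
theorem phiHatNearClosed_holds (hL : 5 ≤ L) {Δ : ℝ} (hΔ0 : 0 ≤ Δ) : PhiHatNearClosed L Δ := by
  intro lam2 f hf h0 e he k hk
  obtain ⟨-, hk'⟩ := phiHatClosedPlusTail_holds L hL hΔ0 lam2 f hf h0 e he
  rw [hk' k hk]
  have e1 : muK L Δ lam2 f e k + (1 / 2 : ℂ) * (1 - zPh L k e) * ((tfun L Δ f k : ℝ) : ℂ)
        + (1 / 2 : ℂ) * tauC L Δ f e k - muK L Δ lam2 f e k
      = (1 / 2 : ℂ) * (1 - zPh L k e) * ((tfun L Δ f k : ℝ) : ℂ) + (1 / 2 : ℂ) * tauC L Δ f e k := by ring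
  rw [e1]
  have hτ : ‖tauC L Δ f e k‖ ≤ tauBar L Δ lam2 f := by
    refine (tauTailBoundC_holds L Δ f e k).trans (le_of_eq ?_)
    rw [gradSNormClosed_holds L (by omega) Δ lam2 f hf e he]
    unfold tauBar sNormSq aPar
    ring
  calc ‖(1 / 2 : ℂ) * (1 - zPh L k e) * ((tfun L Δ f k : ℝ) : ℂ) + (1 / 2 : ℂ) * tauC L Δ f e k‖
      ≤ ‖(1 / 2 : ℂ) * (1 - zPh L k e) * ((tfun L Δ f k : ℝ) : ℂ)‖ + ‖(1 / 2 : ℂ) * tauC L Δ f e k‖ :=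
        norm_add_le _ _
    _ = ‖(1 : ℂ) - zPh L k e‖ / 2 * |tfun L Δ f k| + ‖tauC L Δ f e k‖ / 2 := by
        rw [norm_mul, norm_mul, norm_mul, Complex.norm_real, Real.norm_eq_abs]
        have : ‖(1 / 2 : ℂ)‖ = 1 / 2 := by
          rw [show (1 / 2 : ℂ) = ((1 / 2 : ℝ) : ℂ) by push_cast; ring, Complex.norm_real]
          norm_num
        rw [this]; ring
    _ ≤ ‖(1 : ℂ) - zPh L k e‖ / 2 * |tfun L Δ f k| + tauBar L Δ lam2 f / 2 := by
        gcongr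

end OuterMaj

end Summit.HubbardSuperconductivity.HubbardSuperconductivity.Theorems.AnisotropyChord.Transfer.Fibre3

end
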